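import Summits.ValiantsHypothesis.ValiantsHypothesis.Theorems.SymPencilBoxFourSevenFiltration
import Summits.ValiantsHypothesis.ValiantsHypothesis.Theorems.SymPencilBoxFourCross
import Summits.ValiantsHypothesis.ValiantsHypothesis.Theorems.SymPencilBoxFourCrossLe
import Summits.ValiantsHypothesis.ValiantsHypothesis.Theorems.SymPencilBoxFourEquality
import Summits.ValiantsHypothesis.ValiantsHypothesis.Theorems.SymPencilPerFourDetectingRadical

/-!
# Route `SymPencil` — `7`-dimensional linear subspaces of `Sing Z(per_4)`, IV: no detecting pair and a
# row (or column) of dimension `≥ 3` force a cross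
# (`--supports` stmt-ValiantsHypothesis-5674 `SdcSuperquadratic`; towards the sizes `m = 21, 22`)

**Theorem** (`le_cross_of_no_detecting`).  Let `W` be a `7`-dimensional space of `4 × 4` matrices
(characteristic `0`) on which all `3 × 3` minor-permanents vanish.  Suppose no pair of rows detects
`W` (for every `p ≠ q` some non-zero `x ∈ W` has rows `p, q` zero) and some row of `W` spans a space
of dimension `≥ 3`.  Then `W` is contained in a CROSS `X_{lc} = {support ⊂ row l ∪ column c}`
(and equals it, both having dimension `7`).  `le_cross_of_no_detecting_col` is the transposed
statement (no detecting pair of columns, a column of dimension `≥ 3`).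

Proof.  For every row order ending in the big row `l`, `SymPencilBoxFourSevenFiltration` leaves
only the profile `(1,1,1,4)`: row `l` is full and each other row carries a non-zero single-row
element of `W`.  Move `l` to position `3` by a row permutation, find the common column `k` of the
single-row elements (`SymPencilBoxFourCross.exists_common_column`), move `k` to position `3` by a
column permutation, and conclude with `SymPencilBoxFourCrossLe.le_cross_of_column_three`.

Context.  Crosses are `7`-dimensional irreducible components of `Sing Z(per_4)`; together with the
detecting-pair case they are expected to exhaust the `7`-dimensional linear subspaces (the remaining
case "all rows and columns of dimension `≤ 2`" is not treated here).  Use: the case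
`(dim ker b, dim im b) = (7, 9)` of a symmetric determinantal representation of `per_4` of size
`21, 22`.  Nothing here bears on `VP ≠ VNP`. [folklore]
-/

noncomputable section

-- single-conjunct layout: Sub = Summit, duplicated namespace component intended
set_option linter.dupNamespace false

namespace Summit.ValiantsHypothesis.ValiantsHypothesis.Theorems.SymPencilBoxFourCrossOf

open Module Finset
open Literature.Computability.AlgebraicComplexity
open Summit.ValiantsHypothesis.ValiantsHypothesis.Theorems.SymPencilBoxFourSevenFiltration
open Summit.ValiantsHypothesis.ValiantsHypothesis.Theorems.SymPencilBoxFourCross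
open Summit.ValiantsHypothesis.ValiantsHypothesis.Theorems.SymPencilBoxFourCrossLe
open Summit.ValiantsHypothesis.ValiantsHypothesis.Theorems.SymPencilBoxFourEquality
open Summit.ValiantsHypothesis.ValiantsHypothesis.Theorems.SymPencilPerFourBlocks
open Summit.ValiantsHypothesis.ValiantsHypothesis.Theorems.SymPencilPerFourDetectingRadical

variable {K : Type*} [Field K]

/-- **No detecting pair of rows and a row of dimension `≥ 3` force `W ≤` a cross.**  See the
module docstring. [folklore] -/
theorem le_cross_of_no_detecting [CharZero K] (W : Submodule K (Fin 4 × Fin 4 → K))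
    (hW : ∀ x ∈ W, ∀ (r c : Fin 3 → Fin 4), Function.Injective r → Function.Injective c →
      ((Matrix.of fun i j => x (i, j)).submatrix r c).permanent = 0)
    (h7 : finrank K W = 7)
    (hnr : ¬ ∃ p q : Fin 4, p ≠ q ∧ ∀ x ∈ W, (∀ j, x (p, j) = 0) → (∀ j, x (q, j) = 0) → x = 0)
    (hl : ∃ l : Fin 4, 3 ≤ finrank K ↥(W.map (LinearMap.funLeft K K fun j : Fin 4 => (l, j)))) :
    ∃ l c : Fin 4, ∀ x ∈ W, ∀ i j : Fin 4, i ≠ l → j ≠ c → x (i, j) = 0 := by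
  classical
  have hcases : ∀ i : Fin 4, i = 0 ∨ i = 1 ∨ i = 2 ∨ i = 3 := by decide
  obtain ⟨l, hl3⟩ := hl
  let ρ : Fin 4 → (Fin 4 × Fin 4 → K) →ₗ[K] (Fin 4 → K) :=
    fun r => LinearMap.funLeft K K fun j => (r, j)
  have hρ : ∀ r x j, ρ r x j = x (r, j) := fun _ _ _ => rfl
  -- Step 1: the profile `(1,1,1,4)` in every row order ending with `l`
  have hprof : ∀ a : Fin 4, a ≠ l →
      finrank K ↥(W.map (ρ l)) = 4 ∧ ∃ z ∈ W, z ≠ 0 ∧ ∀ i, i ≠ a → ∀ j, z (i, j) = 0 := by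
    intro a hal
    obtain ⟨σ, hσ0, hσ1⟩ := exists_perm_zero_one a l hal
    set e : Equiv.Perm (Fin 4) := σ * Equiv.swap 1 3 with he
    have he0 : e 0 = a := by
      rw [he, Equiv.Perm.mul_apply, Equiv.swap_apply_of_ne_of_ne (by decide) (by decide), hσ0]
    have he3 : e 3 = l := by rw [he, Equiv.Perm.mul_apply, Equiv.swap_apply_right, hσ1]
    rcases filtration_seven W hW h7 e with hdet | hle2 | ⟨h4, h1, -⟩
    · exact absurd hdet hnr
    · rw [he3] at hle2
      change finrank K ↥(W.map (ρ l)) ≤ 2 at hle2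
      change 3 ≤ finrank K ↥(W.map (ρ l)) at hl3
      omega
    · rw [he3] at h4
      refine ⟨h4, ?_⟩
      set A : Submodule K (Fin 4 × Fin 4 → K) :=
        W ⊓ LinearMap.ker (LinearMap.funLeft K K fun j : Fin 4 => (e 3, j)) ⊓
          LinearMap.ker (LinearMap.funLeft K K fun j : Fin 4 => (e 2, j)) ⊓
          LinearMap.ker (LinearMap.funLeft K K fun j : Fin 4 => (e 1, j)) with hA
      have hA0 : A ≠ ⊥ := fun h => by
        rw [h, finrank_bot] at h1
        exact absurd h1 (by decide)
      obtain ⟨z, hzA, hz0⟩ := Submodule.exists_mem_ne_zero_of_ne_bot hA0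
      simp only [hA, Submodule.mem_inf, LinearMap.mem_ker] at hzA
      obtain ⟨⟨⟨hzW, hz3⟩, hz2⟩, hz1⟩ := hzA
      refine ⟨z, hzW, hz0, fun i hi j => ?_⟩
      obtain ⟨k, rfl⟩ := e.surjective i
      rcases hcases k with rfl | rfl | rfl | rfl
      · exact absurd he0 hi
      · exact congr_fun hz1 j
      · exact congr_fun hz2 j
      · exact congr_fun hz3 j
  obtain ⟨a₀, ha₀⟩ : ∃ a : Fin 4, a ≠ l := ⟨l + 1, by
    intro h
    have := congrArg (fun x : Fin 4 => x - l) h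
    simp at this⟩
  have hR : finrank K ↥(W.map (ρ l)) = 4 := (hprof a₀ ha₀).1
  have hz : ∀ a : Fin 4, a ≠ l → ∃ z ∈ W, z ≠ 0 ∧ ∀ i, i ≠ a → ∀ j, z (i, j) = 0 :=
    fun a ha => (hprof a ha).2
  -- Step 2: move row `l` to position `3`
  set τ : Equiv.Perm (Fin 4) := Equiv.swap l 3 with hτ
  have hτ3 : τ 3 = l := by rw [hτ, Equiv.swap_apply_right]
  set Φ := LinearEquiv.funCongrLeft K K (Equiv.prodCongr τ (1 : Equiv.Perm (Fin 4))) with hΦ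
  have hΦa : ∀ (x : Fin 4 × Fin 4 → K) i j, Φ x (i, j) = x (τ i, j) := fun x i j => rfl
  set W₁ := W.map Φ.toLinearMap with hW₁def
  have hW₁ := subperm_vanish_map_prodCongr W τ 1 hW
  rw [← hΦ, ← hW₁def] at hW₁
  have h7₁ : finrank K W₁ = 7 := by rw [hW₁def, LinearEquiv.finrank_map_eq, h7]
  have hmap₁ : W₁.map (ρ 3) = W.map (ρ l) := by
    rw [hW₁def, ← Submodule.map_comp]
    congr 1
    apply LinearMap.ext
    intro x
    funext j
    show x (τ 3, j) = x (l, j)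
    rw [hτ3]
  have hR₁ : finrank K ↥(W₁.map (LinearMap.funLeft K K fun j : Fin 4 => ((3 : Fin 4), j))) = 4 := by
    change finrank K ↥(W₁.map (ρ 3)) = 4
    rw [hmap₁]; exact hR
  have hz₁ : ∀ a : Fin 4, a ≠ 3 → ∃ z ∈ W₁, z ≠ 0 ∧ ∀ i, i ≠ a → ∀ j, z (i, j) = 0 := by
    intro a ha
    have hτa : τ a ≠ l := fun h => ha (τ.injective (h.trans hτ3.symm))
    obtain ⟨z, hzW, hz0, hzr⟩ := hz (τ a) hτa
    refine ⟨Φ z, ⟨z, hzW, rfl⟩, fun h => hz0 (Φ.map_eq_zero_iff.1 h), fun i hi j => ?_⟩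
    rw [hΦa]
    exact hzr (τ i) (fun h => hi (τ.injective h)) j
  obtain ⟨k, hk⟩ := exists_common_column W₁ hW₁ hR₁ hz₁
  -- Step 3: move column `k` to position `3`
  set κ : Equiv.Perm (Fin 4) := Equiv.swap k 3 with hκ
  have hκ3 : κ 3 = k := by rw [hκ, Equiv.swap_apply_right]
  set Ψ := LinearEquiv.funCongrLeft K K (Equiv.prodCongr (1 : Equiv.Perm (Fin 4)) κ) with hΨ
  have hΨa : ∀ (x : Fin 4 × Fin 4 → K) i j, Ψ x (i, j) = x (i, κ j) := fun x i j => rfl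
  set W₂ := W₁.map Ψ.toLinearMap with hW₂def
  have hW₂ := subperm_vanish_map_prodCongr W₁ 1 κ hW₁
  rw [← hΨ, ← hW₂def] at hW₂
  have h7₂ : finrank K W₂ = 7 := by rw [hW₂def, LinearEquiv.finrank_map_eq, h7₁]
  have hcomp : (ρ 3) ∘ₗ Ψ.toLinearMap = (LinearEquiv.funCongrLeft K K κ).toLinearMap ∘ₗ (ρ 3) := by
    apply LinearMap.ext
    intro x
    funext j
    rfl
  have hmap₂ : W₂.map (ρ 3) = (W₁.map (ρ 3)).map (LinearEquiv.funCongrLeft K K κ).toLinearMap := by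
    rw [hW₂def, ← Submodule.map_comp, hcomp, Submodule.map_comp]
  have hR₂ : finrank K ↥(W₂.map (LinearMap.funLeft K K fun j : Fin 4 => ((3 : Fin 4), j))) = 4 := by
    change finrank K ↥(W₂.map (ρ 3)) = 4
    rw [hmap₂, LinearEquiv.finrank_map_eq]
    exact hR₁
  have hz₂ : ∀ a : Fin 4, a ≠ 3 → ∃ z ∈ W₂, z (a, 3) ≠ 0 ∧ ∀ p, p ≠ (a, 3) → z p = 0 := by
    intro a ha
    obtain ⟨z, hzW, hzk, hzp⟩ := hk a ha
    refine ⟨Ψ z, ⟨z, hzW, rfl⟩, by rw [hΨa, hκ3]; exact hzk, ?_⟩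
    rintro ⟨i, j⟩ hp
    rw [hΨa]
    apply hzp
    intro h
    apply hp
    have hi : i = a := congrArg Prod.fst h
    have hj : κ j = k := congrArg Prod.snd h
    rw [hi, show j = 3 from κ.injective (hj.trans hκ3.symm)]
  have hcross := le_cross_of_column_three W₂ hW₂ h7₂ hR₂ hz₂
  -- Step 4: back to `W`
  refine ⟨l, k, fun x hx i j hi hj => ?_⟩
  have hmem : Ψ (Φ x) ∈ W₂ := ⟨Φ x, ⟨x, hx, rfl⟩, rfl⟩
  have h := hcross _ hmem (τ i) (κ j)
    (fun h => hi (by rw [← hτ3, ← h, hτ, Equiv.swap_apply_self]))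
    (fun h => hj (by rw [← hκ3, ← h, hκ, Equiv.swap_apply_self]))
  rw [hΨa, hΦa, hτ, hκ, Equiv.swap_apply_self, Equiv.swap_apply_self] at h
  exact h

/-- **No detecting pair of columns and a column of dimension `≥ 3` force `W ≤` a cross**
(transpose of `le_cross_of_no_detecting`). [folklore] -/
theorem le_cross_of_no_detecting_col [CharZero K] (W : Submodule K (Fin 4 × Fin 4 → K))
    (hW : ∀ x ∈ W, ∀ (r c : Fin 3 → Fin 4), Function.Injective r → Function.Injective c →
      ((Matrix.of fun i j => x (i, j)).submatrix r c).permanent = 0)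
    (h7 : finrank K W = 7)
    (hnc : ¬ ∃ p q : Fin 4, p ≠ q ∧ ∀ x ∈ W, (∀ i, x (i, p) = 0) → (∀ i, x (i, q) = 0) → x = 0)
    (hc : ∃ c : Fin 4, 3 ≤ finrank K ↥(W.map (LinearMap.funLeft K K fun i : Fin 4 => (i, c)))) :
    ∃ l c : Fin 4, ∀ x ∈ W, ∀ i j : Fin 4, i ≠ l → j ≠ c → x (i, j) = 0 := by
  set Θ := LinearEquiv.funCongrLeft K K (Equiv.prodComm (Fin 4) (Fin 4)) with hΘ
  have hΘa : ∀ (x : Fin 4 × Fin 4 → K) i j, Θ x (i, j) = x (j, i) := fun x i j => rfl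
  set W' := W.map Θ.toLinearMap with hW'def
  have hW' := subperm_vanish_transpose W hW
  rw [← hΘ, ← hW'def] at hW'
  have h7' : finrank K W' = 7 := by rw [hW'def, LinearEquiv.finrank_map_eq, h7]
  have hnr' : ¬ ∃ p q : Fin 4, p ≠ q ∧ ∀ y ∈ W', (∀ j, y (p, j) = 0) → (∀ j, y (q, j) = 0) →
      y = 0 := by
    rintro ⟨p, q, hpq, hdet⟩
    refine hnc ⟨p, q, hpq, fun x hx hp hq => ?_⟩
    have h := hdet (Θ x) ⟨x, hx, rfl⟩ (fun j => by rw [hΘa]; exact hp j)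
      (fun j => by rw [hΘa]; exact hq j)
    exact Θ.map_eq_zero_iff.1 h
  have hl' : ∃ l : Fin 4, 3 ≤ finrank K ↥(W'.map (LinearMap.funLeft K K fun j : Fin 4 => (l, j))) := by
    obtain ⟨c, hc3⟩ := hc
    refine ⟨c, ?_⟩
    have hmap : W'.map (LinearMap.funLeft K K fun j : Fin 4 => (c, j)) =
        W.map (LinearMap.funLeft K K fun i : Fin 4 => (i, c)) := by
      rw [hW'def, ← Submodule.map_comp]
      rfl
    rw [hmap]; exact hc3
  obtain ⟨l, c, h⟩ := le_cross_of_no_detecting W' hW' h7' hnr' hl'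
  refine ⟨c, l, fun x hx i j hi hj => ?_⟩
  have := h (Θ x) ⟨x, hx, rfl⟩ j i hj hi
  rwa [hΘa] at this

end Summit.ValiantsHypothesis.ValiantsHypothesis.Theorems.SymPencilBoxFourCrossOf

end
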